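import Summits.CriticalPhenomena.PercolationContinuityZ3.Theorems.PercNearOneGluingNoHeavyLowerTailSahiGridPatternTwoChart

/-!
# `NoHeavyLowerTail` (crux stmt-CriticalPhenomena-4575), Sahi programme P1: **EVERY TOP-CUBE UP-SET DOMINATES ITS HARRIS SLACK**
# — generation 18's CONJECTURE B, every dimension: `sStarD U B C ≥ H(U, B∩C)` for all up-sets `U ⊆ {1,2}^k ⊆ [3]^k` and `B, C ⊆ [3]^k`

Support file (Sahi cell, seat `prim-sahi-p1`, generation 19; `--supports stmt-CriticalPhenomena-4575`).  Pure proofs, NO definitions,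
no `sorry`, standard axioms.  Vocabulary of `…SahiGridPattern{,ZDecomp,HarrisReduced,OrthantHarris,TwoChart}`: the chart `fromSet u T`
of the Boolean cube of points totally distinct from `u`; the top-cube point with twos exactly on `S ⊆ [k]` is `fromSet 0 S` (values in
`{1,2}`), and `fromSet (fromSet 0 S) T` is the corner point `1` on `S∩T`, `2` on `T∖S`, `0` off `T`.

THE MATHEMATICS.  `G(U;B,C) := sStarD U B C − H(U,B∩C) = sStarD U B C + N(U;B∩C) − 2^k·#(U∩B∩C)` (generation 18).  By the witness
formula (`harrisReduced_eq_sum`) `G(U;B,C) = Σ_{u∈U} Σ_T (1_B(u^T) − 1_B(u))(1_C(u^{Tᶜ}) − 1_C(u))`; pairing the chart `T` with `Tᶜ`,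
`2·G(U;B,C) = Σ_T Σ_{u∈U} [(1_B(u^T) − 1_B(u))(1_C(u^{Tᶜ}) − 1_C(u)) + (1_B(u^{Tᶜ}) − 1_B(u))(1_C(u^T) − 1_C(u))]`, and for `U` an up-set
INSIDE THE TOP CUBE `{1,2}^k` each chart-pair sum is an instance of the two-chart transport lemma `twoChart_sum_nonneg` (blocks
`α = β = 2^[k]` inflated along `(X,Y) ↦ (X∩T) ∪ (Y∩Tᶜ)`, the recombination `(X,Y) ↦ ((X∩T)∪(Y∩Tᶜ), (Y∩T)∪(X∩Tᶜ))` being an involution;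
arms = bottom slices `X ↦ 1_B(fromSet 0 (X∩T))`, corners `X ↦ 1_B((fromSet 0 X)^T)`, HK-domination from Harris–Kleitman in `2^[k]`
and the injection `X ↦ X ∆ T`), hence `≥ 0` (**`chartPair_sum_nonneg`**).  THEOREM (**`sStarD_topCube_ge_harris`**, every `k`): for every
up-set `U ⊆ [3]^k` all of whose points have no zero coordinate and all up-sets `B, C`,
  `2^k·#(U∩B∩C) ≤ sStarD U B C + N(U;B∩C)`,  i.e.  `sStarD U B C ≥ H(U,B∩C) ≥ 0`.
This is generation 18's CONJECTURE B (census: exhaustive `k ≤ 5` via the abstract claim, prim-sahi-census §49) proved for ALL `k`; it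
contains the orthant theorem `sStarD_principal_ge_harris` for principal up-sets above `1^k` and gives a Boolean algebra of new good
slots (`sStarD_topCube_nonneg`): every `{x ≥ 1^k : twos(x) ∈ 𝒰}`, `𝒰 ⊆ 2^[k]` an up-family — e.g. `{x ≥ 1^k : #twos(x) ≥ j}`.  The
cylinder / every-dimension consequences via diagonal certificates are in the companion file `…SahiGridPatternTopCubeCyl`.
Nothing here asserts `PatternPos d` for any `d ≥ 4`. [this work]
-/

namespace Summit.CriticalPhenomena.PercolationContinuityZ3.Theorems.SahiGridPattern

open Finset SahiGrid3
open scoped BigOperators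

variable {k : ℕ}

/-! ### Top-cube points `fromSet 0 S` and their corner points `fromSet (fromSet 0 S) T` -/

/-- The six values of `hiVal` / `loVal` (bookkeeping). [this work] -/
theorem hiVal_loVal_values : hiVal (0 : Fin 3) = 2 ∧ loVal (0 : Fin 3) = 1 ∧ hiVal (1 : Fin 3) = 2 ∧ hiVal (2 : Fin 3) = 1 ∧
    loVal (1 : Fin 3) = 0 ∧ loVal (2 : Fin 3) = 0 := by decide

/-- The order facts on `Fin 3` used below (bookkeeping). [this work] -/
theorem fin3_le_facts : (0 : Fin 3) ≤ 1 ∧ (1 : Fin 3) ≤ 2 ∧ (0 : Fin 3) ≤ 2 ∧ ¬ ((2 : Fin 3) ≤ 1) := by decide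

/-- The top-cube point of `S`: value `2` on `S`, `1` off `S`. [this work] -/
theorem fromSet_zero_apply (S : Finset (Fin k)) (a : Fin k) : fromSet (0 : Pd k) S a = if a ∈ S then 2 else 1 := by
  have h0 : (0 : Pd k) a = 0 := rfl
  unfold fromSet
  rw [h0]
  by_cases h : a ∈ S
  · rw [if_pos h, if_pos h, hiVal_loVal_values.1]
  · rw [if_neg h, if_neg h, hiVal_loVal_values.2.1]

/-- Top-cube points have no zero coordinate. [this work] -/
theorem fromSet_zero_ne_zero (S : Finset (Fin k)) (a : Fin k) : fromSet (0 : Pd k) S a ≠ 0 := by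
  rw [fromSet_zero_apply]
  have h12 : (1 : Fin 3) ≠ 0 ∧ (2 : Fin 3) ≠ 0 := by decide
  split_ifs
  · exact h12.2
  · exact h12.1

/-- The corner point of `S` on the chart `T`: `1` on `S ∩ T`, `2` on `T ∖ S`, `0` off `T`. [this work] -/
theorem fromSet_fromSet_zero_apply (S T : Finset (Fin k)) (a : Fin k) :
    fromSet (fromSet (0 : Pd k) S) T a = if a ∈ T then (if a ∈ S then 1 else 2) else 0 := by
  show (if a ∈ T then hiVal (fromSet (0 : Pd k) S a) else loVal (fromSet (0 : Pd k) S a)) = _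
  rw [fromSet_zero_apply]
  obtain ⟨-, -, h1, h2, l1, l2⟩ := hiVal_loVal_values
  by_cases hT : a ∈ T <;> by_cases hS : a ∈ S <;> simp only [hT, hS, if_true, if_false, h1, h2, l1, l2]

/-- The corner point on `T` depends only on `S ∩ T`. [this work] -/
theorem fromSet_fromSet_zero_congr (T : Finset (Fin k)) {S S' : Finset (Fin k)} (h : ∀ a ∈ T, (a ∈ S ↔ a ∈ S')) :
    fromSet (fromSet (0 : Pd k) S) T = fromSet (fromSet (0 : Pd k) S') T := by
  funext a
  rw [fromSet_fromSet_zero_apply, fromSet_fromSet_zero_apply]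
  by_cases hT : a ∈ T
  · simp only [hT, if_true, h a hT]
  · simp only [hT, if_false]

/-- The corner point is ANTITONE in `S`. [this work] -/
theorem fromSet_fromSet_zero_anti (T : Finset (Fin k)) {S S' : Finset (Fin k)} (h : S ⊆ S') :
    fromSet (fromSet (0 : Pd k) S') T ≤ fromSet (fromSet (0 : Pd k) S) T := by
  intro a
  rw [fromSet_fromSet_zero_apply, fromSet_fromSet_zero_apply]
  by_cases hT : a ∈ T
  · by_cases hS : a ∈ S
    · simp only [hT, hS, h hS, if_true]; exact le_rfl
    · simp only [hT, hS, if_true, if_false]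
      split_ifs
      · exact fin3_le_facts.2.1
      · exact le_rfl
  · simp only [hT, if_false]; exact le_rfl

/-- The corner point of `S` on `T` lies below the top-cube point of `T ∖ S`. [this work] -/
theorem fromSet_fromSet_zero_le_sdiff (S T : Finset (Fin k)) :
    fromSet (fromSet (0 : Pd k) S) T ≤ fromSet (0 : Pd k) (T \ S) := by
  intro a
  rw [fromSet_fromSet_zero_apply, fromSet_zero_apply]
  by_cases hT : a ∈ T <;> by_cases hS : a ∈ S <;>
    simp only [Finset.mem_sdiff, hT, hS, if_true, if_false, not_true, not_false_iff, and_false, and_true] <;>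
    first | exact le_rfl | exact fin3_le_facts.1

/-- The top-cube point is monotone in `S`. [this work] -/
theorem fromSet_zero_mono {S S' : Finset (Fin k)} (h : S ⊆ S') : fromSet (0 : Pd k) S ≤ fromSet (0 : Pd k) S' :=
  fromSet_mono 0 h

/-! ### The inflated data of a chart: arms, corners, HK-domination -/

/-- The arm `{X : fromSet 0 (X ∩ R) ∈ B}` is an upper family. [this work] -/
theorem isUpperSet_arm (R : Finset (Fin k)) {B : Finset (Pd k)} (hB : IsUpperSet (B : Set (Pd k))) :
    IsUpperSet ((univ.filter fun X : Finset (Fin k) => fromSet (0 : Pd k) (X ∩ R) ∈ B : Finset (Finset (Fin k))) :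
      Set (Finset (Fin k))) := by
  intro X X' hXX' hX
  rw [Finset.mem_coe, Finset.mem_filter] at hX ⊢
  exact ⟨mem_univ _, hB (fromSet_zero_mono (Finset.inter_subset_inter hXX' (Finset.Subset.refl R))) hX.2⟩

/-- The corner family `{X : (fromSet 0 X)^R ∈ B}` is a lower family. [this work] -/
theorem isLowerSet_corner (R : Finset (Fin k)) {B : Finset (Pd k)} (hB : IsUpperSet (B : Set (Pd k))) :
    IsLowerSet ((univ.filter fun X : Finset (Fin k) => fromSet (fromSet (0 : Pd k) X) R ∈ B : Finset (Finset (Fin k))) :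
      Set (Finset (Fin k))) := by
  intro X X' hX'X hX
  rw [Finset.mem_coe, Finset.mem_filter] at hX ⊢
  exact ⟨mem_univ _, hB (fromSet_fromSet_zero_anti R hX'X) hX.2⟩

/-- The symmetric difference with `R`, written with `sdiff`/`union`, is an involution. [this work] -/
theorem sdiff_union_sdiff_invol (R X : Finset (Fin k)) : (R \ ((R \ X) ∪ (X \ R))) ∪ (((R \ X) ∪ (X \ R)) \ R) = X := by
  ext a
  simp only [Finset.mem_union, Finset.mem_sdiff]
  tauto

/-- `((R ∖ X) ∪ (X ∖ R)) ∩ R = R ∖ X`. [this work] -/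
theorem sdiff_union_sdiff_inter (R X : Finset (Fin k)) : ((R \ X) ∪ (X \ R)) ∩ R = R \ X := by
  ext a
  simp only [Finset.mem_union, Finset.mem_sdiff, Finset.mem_inter]
  tauto

/-- **HK-domination of the corner family by the arm** (Harris–Kleitman in `2^[k]` and the injection `X ↦ X ∆ R`): for every upper family
`V`, `#(V ∩ {X : (fromSet 0 X)^R ∈ B}) ≤ #(V ∩ {X : fromSet 0 (X∩R) ∈ B})`. [this work] -/
theorem hk_chart (R : Finset (Fin k)) {B : Finset (Pd k)} (hB : IsUpperSet (B : Set (Pd k)))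
    (V : Finset (Finset (Fin k))) (hV : IsUpperSet (V : Set (Finset (Fin k)))) :
    (V ∩ (univ.filter fun X : Finset (Fin k) => fromSet (fromSet (0 : Pd k) X) R ∈ B)).card ≤
      (V ∩ (univ.filter fun X : Finset (Fin k) => fromSet (0 : Pd k) (X ∩ R) ∈ B)).card := by
  refine card_inter_le_card_inter_of_card_le hV (isUpperSet_arm R hB) (isLowerSet_corner R hB) ?_
  refine Finset.card_le_card_of_injOn (fun X => (R \ X) ∪ (X \ R)) (fun X hX => ?_) (fun X hX X' hX' h => ?_)
  · rw [Finset.mem_coe, Finset.mem_filter] at hX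
    rw [Finset.mem_coe, Finset.mem_filter]
    refine ⟨mem_univ _, ?_⟩
    rw [sdiff_union_sdiff_inter]
    exact hB (fromSet_fromSet_zero_le_sdiff X R) hX.2
  · have h' : (R \ X) ∪ (X \ R) = (R \ X') ∪ (X' \ R) := h
    calc X = (R \ ((R \ X) ∪ (X \ R))) ∪ (((R \ X) ∪ (X \ R)) \ R) := (sdiff_union_sdiff_invol R X).symm
      _ = (R \ ((R \ X') ∪ (X' \ R))) ∪ (((R \ X') ∪ (X' \ R)) \ R) := by rw [h']
      _ = X' := sdiff_union_sdiff_invol R X'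

/-- The inflation of an up-set of `[3]^k` along `(X,Y) ↦ fromSet 0 ((X∩T) ∪ (Y∩Tᶜ))` is an up-set of `2^[k] × 2^[k]`. [this work] -/
theorem isUpperSet_inflate (T : Finset (Fin k)) {W : Finset (Pd k)} (hW : IsUpperSet (W : Set (Pd k))) :
    IsUpperSet ((univ.filter fun p : Finset (Fin k) × Finset (Fin k) => fromSet (0 : Pd k) ((p.1 ∩ T) ∪ (p.2 ∩ Tᶜ)) ∈ W :
      Finset (Finset (Fin k) × Finset (Fin k))) : Set (Finset (Fin k) × Finset (Fin k))) := by
  intro p q hpq hp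
  rw [Finset.mem_coe, Finset.mem_filter] at hp ⊢
  refine ⟨mem_univ _, hW (fromSet_zero_mono ?_) hp.2⟩
  exact Finset.union_subset_union (Finset.inter_subset_inter hpq.1 (Finset.Subset.refl T))
    (Finset.inter_subset_inter hpq.2 (Finset.Subset.refl Tᶜ))

/-- The first arm lies in the inflated set: `fromSet 0 (X∩T) ∈ W ⟹ fromSet 0 ((X∩T) ∪ (Y∩Tᶜ)) ∈ W`. [this work] -/
theorem arm_fst_mem (T : Finset (Fin k)) {W : Finset (Pd k)} (hW : IsUpperSet (W : Set (Pd k))) :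
    ∀ X ∈ (univ.filter fun X : Finset (Fin k) => fromSet (0 : Pd k) (X ∩ T) ∈ W), ∀ Y : Finset (Fin k),
      (X, Y) ∈ (univ.filter fun p : Finset (Fin k) × Finset (Fin k) => fromSet (0 : Pd k) ((p.1 ∩ T) ∪ (p.2 ∩ Tᶜ)) ∈ W) := by
  intro X hX Y
  rw [Finset.mem_filter] at hX ⊢
  exact ⟨mem_univ _, hW (fromSet_zero_mono Finset.subset_union_left) hX.2⟩

/-- The second arm lies in the inflated set. [this work] -/
theorem arm_snd_mem (T : Finset (Fin k)) {W : Finset (Pd k)} (hW : IsUpperSet (W : Set (Pd k))) :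
    ∀ Y ∈ (univ.filter fun Y : Finset (Fin k) => fromSet (0 : Pd k) (Y ∩ Tᶜ) ∈ W), ∀ X : Finset (Fin k),
      (X, Y) ∈ (univ.filter fun p : Finset (Fin k) × Finset (Fin k) => fromSet (0 : Pd k) ((p.1 ∩ T) ∪ (p.2 ∩ Tᶜ)) ∈ W) := by
  intro Y hY X
  rw [Finset.mem_filter] at hY ⊢
  exact ⟨mem_univ _, hW (fromSet_zero_mono Finset.subset_union_right) hY.2⟩

/-! ### Reading the inflated indicators back on `[3]^k` -/

/-- The corner indicator of the first block is `1_W` at the chart point `u^T`. [this work] -/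
theorem ind_corner_fst (T : Finset (Fin k)) (W : Finset (Pd k)) (p : Finset (Fin k) × Finset (Fin k)) :
    ind (univ.filter fun X : Finset (Fin k) => fromSet (fromSet (0 : Pd k) X) T ∈ W) p.1
      = ind W (fromSet (fromSet (0 : Pd k) ((p.1 ∩ T) ∪ (p.2 ∩ Tᶜ))) T) := by
  have e : fromSet (fromSet (0 : Pd k) ((p.1 ∩ T) ∪ (p.2 ∩ Tᶜ))) T = fromSet (fromSet (0 : Pd k) p.1) T :=
    fromSet_fromSet_zero_congr T fun a ha => by
      simp only [Finset.mem_union, Finset.mem_inter, Finset.mem_compl]; tauto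
  unfold ind
  simp only [Finset.mem_filter, Finset.mem_univ, true_and, e]

/-- The corner indicator of the second block is `1_W` at the chart point `u^{Tᶜ}`. [this work] -/
theorem ind_corner_snd (T : Finset (Fin k)) (W : Finset (Pd k)) (p : Finset (Fin k) × Finset (Fin k)) :
    ind (univ.filter fun Y : Finset (Fin k) => fromSet (fromSet (0 : Pd k) Y) Tᶜ ∈ W) p.2
      = ind W (fromSet (fromSet (0 : Pd k) ((p.1 ∩ T) ∪ (p.2 ∩ Tᶜ))) Tᶜ) := by
  have e : fromSet (fromSet (0 : Pd k) ((p.1 ∩ T) ∪ (p.2 ∩ Tᶜ))) Tᶜ = fromSet (fromSet (0 : Pd k) p.2) Tᶜ :=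
    fromSet_fromSet_zero_congr Tᶜ fun a ha => by
      rw [Finset.mem_compl] at ha
      simp only [Finset.mem_union, Finset.mem_inter, Finset.mem_compl]; tauto
  unfold ind
  simp only [Finset.mem_filter, Finset.mem_univ, true_and, e]

/-- The inflated indicator is `1_W` at the top-cube point. [this work] -/
theorem ind_inflate (T : Finset (Fin k)) (W : Finset (Pd k)) (p : Finset (Fin k) × Finset (Fin k)) :
    ind (univ.filter fun p : Finset (Fin k) × Finset (Fin k) => fromSet (0 : Pd k) ((p.1 ∩ T) ∪ (p.2 ∩ Tᶜ)) ∈ W) p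
      = ind W (fromSet (0 : Pd k) ((p.1 ∩ T) ∪ (p.2 ∩ Tᶜ))) := by
  unfold ind
  simp only [Finset.mem_filter, Finset.mem_univ, true_and]

/-! ### The chart-pair inequality -/

/-- **The inflated chart-pair sum is nonnegative** (the two-chart transport lemma applied to the chart `T`). [this work] -/
theorem inflated_sum_nonneg (T : Finset (Fin k)) {U B C : Finset (Pd k)} (hU : IsUpperSet (U : Set (Pd k)))
    (hB : IsUpperSet (B : Set (Pd k))) (hC : IsUpperSet (C : Set (Pd k))) :
    0 ≤ ∑ p ∈ (univ.filter fun p : Finset (Fin k) × Finset (Fin k) => fromSet (0 : Pd k) ((p.1 ∩ T) ∪ (p.2 ∩ Tᶜ)) ∈ U),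
      ((ind B (fromSet (fromSet (0 : Pd k) ((p.1 ∩ T) ∪ (p.2 ∩ Tᶜ))) T) - ind B (fromSet (0 : Pd k) ((p.1 ∩ T) ∪ (p.2 ∩ Tᶜ))))
        * (ind C (fromSet (fromSet (0 : Pd k) ((p.1 ∩ T) ∪ (p.2 ∩ Tᶜ))) Tᶜ) - ind C (fromSet (0 : Pd k) ((p.1 ∩ T) ∪ (p.2 ∩ Tᶜ))))
      + (ind B (fromSet (fromSet (0 : Pd k) ((p.1 ∩ T) ∪ (p.2 ∩ Tᶜ))) Tᶜ) - ind B (fromSet (0 : Pd k) ((p.1 ∩ T) ∪ (p.2 ∩ Tᶜ))))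
        * (ind C (fromSet (fromSet (0 : Pd k) ((p.1 ∩ T) ∪ (p.2 ∩ Tᶜ))) T) - ind C (fromSet (0 : Pd k) ((p.1 ∩ T) ∪ (p.2 ∩ Tᶜ))))) := by
  have h := twoChart_sum_nonneg
    (univ.filter fun p : Finset (Fin k) × Finset (Fin k) => fromSet (0 : Pd k) ((p.1 ∩ T) ∪ (p.2 ∩ Tᶜ)) ∈ U)
    (univ.filter fun p : Finset (Fin k) × Finset (Fin k) => fromSet (0 : Pd k) ((p.1 ∩ T) ∪ (p.2 ∩ Tᶜ)) ∈ B)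
    (univ.filter fun p : Finset (Fin k) × Finset (Fin k) => fromSet (0 : Pd k) ((p.1 ∩ T) ∪ (p.2 ∩ Tᶜ)) ∈ C)
    (isUpperSet_inflate T hU) (isUpperSet_inflate T hB) (isUpperSet_inflate T hC)
    (univ.filter fun X : Finset (Fin k) => fromSet (0 : Pd k) (X ∩ T) ∈ B)
    (univ.filter fun X : Finset (Fin k) => fromSet (0 : Pd k) (X ∩ T) ∈ C)
    (univ.filter fun X : Finset (Fin k) => fromSet (fromSet (0 : Pd k) X) T ∈ B)
    (univ.filter fun X : Finset (Fin k) => fromSet (fromSet (0 : Pd k) X) T ∈ C)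
    (univ.filter fun Y : Finset (Fin k) => fromSet (0 : Pd k) (Y ∩ Tᶜ) ∈ B)
    (univ.filter fun Y : Finset (Fin k) => fromSet (0 : Pd k) (Y ∩ Tᶜ) ∈ C)
    (univ.filter fun Y : Finset (Fin k) => fromSet (fromSet (0 : Pd k) Y) Tᶜ ∈ C)
    (univ.filter fun Y : Finset (Fin k) => fromSet (fromSet (0 : Pd k) Y) Tᶜ ∈ B)
    (isUpperSet_arm T hB) (isUpperSet_arm T hC) (isUpperSet_arm Tᶜ hB) (isUpperSet_arm Tᶜ hC)
    (isLowerSet_corner T hB) (isLowerSet_corner T hC) (isLowerSet_corner Tᶜ hC) (isLowerSet_corner Tᶜ hB)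
    (arm_fst_mem T hB) (arm_snd_mem T hB) (arm_fst_mem T hC) (arm_snd_mem T hC)
    (hk_chart T hB) (hk_chart T hC) (hk_chart Tᶜ hC) (hk_chart Tᶜ hB)
  refine le_trans h (le_of_eq (Finset.sum_congr rfl fun p _ => ?_))
  rw [ind_corner_fst T B p, ind_corner_fst T C p, ind_corner_snd T B p, ind_corner_snd T C p, ind_inflate T B p, ind_inflate T C p]

/-- The recombination `(X,Y) ↦ ((X∩T) ∪ (Y∩Tᶜ), (Y∩T) ∪ (X∩Tᶜ))` is an involution of `2^[k] × 2^[k]`. [this work] -/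
theorem recomb_involutive (T : Finset (Fin k)) :
    Function.Involutive (fun p : Finset (Fin k) × Finset (Fin k) => ((p.1 ∩ T) ∪ (p.2 ∩ Tᶜ), (p.2 ∩ T) ∪ (p.1 ∩ Tᶜ))) := by
  intro p
  obtain ⟨X, Y⟩ := p
  refine Prod.ext ?_ ?_
  · ext a; simp only [Finset.mem_union, Finset.mem_inter, Finset.mem_compl]; tauto
  · ext a; simp only [Finset.mem_union, Finset.mem_inter, Finset.mem_compl]; tauto

/-- Top-cube points are charts of `0`: `u = fromSet 0 (toSet 0 u)` when `u` has no zero coordinate. [this work] -/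
theorem fromSet_toSet_zero {u : Pd k} (hu : ∀ a, u a ≠ 0) : fromSet (0 : Pd k) (toSet 0 u) = u :=
  fromSet_toSet (totDist_iff.2 fun a => by rw [Pi.zero_apply]; exact hu a)

/-- **THE CHART-PAIR INEQUALITY** (every `k`, every chart `T`): for an up-set `U` inside the top cube and up-sets `B, C`,
`Σ_{u∈U} [(1_B(u^T) − 1_B(u))(1_C(u^{Tᶜ}) − 1_C(u)) + (1_B(u^{Tᶜ}) − 1_B(u))(1_C(u^T) − 1_C(u))] ≥ 0`. [this work] -/
theorem chartPair_sum_nonneg (T : Finset (Fin k)) {U B C : Finset (Pd k)} (hU : IsUpperSet (U : Set (Pd k)))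
    (htop : ∀ u ∈ U, ∀ a, u a ≠ 0) (hB : IsUpperSet (B : Set (Pd k))) (hC : IsUpperSet (C : Set (Pd k))) :
    0 ≤ ∑ u ∈ U, ((ind B (fromSet u T) - ind B u) * (ind C (fromSet u Tᶜ) - ind C u)
      + (ind B (fromSet u Tᶜ) - ind B u) * (ind C (fromSet u T) - ind C u)) := by
  -- the chart-pair function, read through the top-cube point of a set
  set g : Finset (Fin k) → ℤ := fun S => if fromSet (0 : Pd k) S ∈ U then
      ((ind B (fromSet (fromSet (0 : Pd k) S) T) - ind B (fromSet (0 : Pd k) S))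
          * (ind C (fromSet (fromSet (0 : Pd k) S) Tᶜ) - ind C (fromSet (0 : Pd k) S))
        + (ind B (fromSet (fromSet (0 : Pd k) S) Tᶜ) - ind B (fromSet (0 : Pd k) S))
          * (ind C (fromSet (fromSet (0 : Pd k) S) T) - ind C (fromSet (0 : Pd k) S))) else 0 with hg
  -- (1) the inflated sum is `Σ_p g(σ p)`
  have h1 : 0 ≤ ∑ p : Finset (Fin k) × Finset (Fin k), g ((p.1 ∩ T) ∪ (p.2 ∩ Tᶜ)) := by
    have h := inflated_sum_nonneg T hU hB hC
    rw [Finset.sum_filter] at h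
    refine le_trans h (le_of_eq (Finset.sum_congr rfl fun p _ => ?_))
    simp only [hg]
  -- (2) recombination: `Σ_p g(σ p) = Σ_p g(p.1) = #(2^[k]) · Σ_S g S`
  have h2 : (∑ p : Finset (Fin k) × Finset (Fin k), g ((p.1 ∩ T) ∪ (p.2 ∩ Tᶜ)))
      = ∑ p : Finset (Fin k) × Finset (Fin k), g p.1 :=
    Equiv.sum_comp (Function.Involutive.toPerm _ (recomb_involutive T)) (fun q : Finset (Fin k) × Finset (Fin k) => g q.1)
  have h3 : (∑ p : Finset (Fin k) × Finset (Fin k), g p.1) = (Fintype.card (Finset (Fin k)) : ℤ) * ∑ S : Finset (Fin k), g S := by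
    rw [Fintype.sum_prod_type, Finset.mul_sum]
    refine Finset.sum_congr rfl fun S _ => ?_
    show (∑ _Y : Finset (Fin k), g S) = _
    rw [Finset.sum_const, Finset.card_univ, nsmul_eq_mul]
  -- (3) `Σ_S g S` is the sum over `U`
  have h4 : (∑ S : Finset (Fin k), g S) = ∑ u ∈ U, ((ind B (fromSet u T) - ind B u) * (ind C (fromSet u Tᶜ) - ind C u)
      + (ind B (fromSet u Tᶜ) - ind B u) * (ind C (fromSet u T) - ind C u)) := by
    have e : (∑ S : Finset (Fin k), g S) = ∑ S ∈ univ.filter (fun S : Finset (Fin k) => fromSet (0 : Pd k) S ∈ U),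
        ((ind B (fromSet (fromSet (0 : Pd k) S) T) - ind B (fromSet (0 : Pd k) S))
            * (ind C (fromSet (fromSet (0 : Pd k) S) Tᶜ) - ind C (fromSet (0 : Pd k) S))
          + (ind B (fromSet (fromSet (0 : Pd k) S) Tᶜ) - ind B (fromSet (0 : Pd k) S))
            * (ind C (fromSet (fromSet (0 : Pd k) S) T) - ind C (fromSet (0 : Pd k) S))) := by
      rw [Finset.sum_filter]
    rw [e]
    refine Finset.sum_nbij' (fun S => fromSet (0 : Pd k) S) (fun u => toSet (0 : Pd k) u) (fun S hS => ?_) (fun u hu => ?_)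
      (fun S _ => toSet_fromSet 0 S) (fun u hu => fromSet_toSet_zero (htop u hu)) (fun S _ => rfl)
    · rw [Finset.mem_filter] at hS; exact hS.2
    · rw [Finset.mem_filter]; exact ⟨mem_univ _, by rw [fromSet_toSet_zero (htop u hu)]; exact hu⟩
  rw [h2, h3, h4] at h1
  have hpos : (0 : ℤ) < (Fintype.card (Finset (Fin k)) : ℤ) := by exact_mod_cast Fintype.card_pos
  exact le_of_mul_le_mul_left (by rw [mul_zero]; exact h1) hpos

/-! ### Conjecture B: every top-cube up-set is Harris-good -/

/-- **EVERY TOP-CUBE UP-SET DOMINATES ITS HARRIS SLACK** (generation 18's CONJECTURE B, every dimension `k`): for an up-set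
`U ⊆ [3]^k` all of whose points have no zero coordinate (`U = {x ≥ 1^k : twos(x) ∈ 𝒰}` for an up-family `𝒰 ⊆ 2^[k]`) and all up-sets
`B, C ⊆ [3]^k`:  `2^k · #(U ∩ B ∩ C) ≤ sStarD U B C + N(U; B∩C)`, i.e. `G(U;B,C) = sStarD U B C − H(U,B∩C) ≥ 0`. [this work] -/
theorem sStarD_topCube_ge_harris (U : Finset (Pd k)) (hU : IsUpperSet (U : Set (Pd k))) (htop : ∀ u ∈ U, ∀ a, u a ≠ 0)
    (B C : Finset (Pd k)) (hB : IsUpperSet (B : Set (Pd k))) (hC : IsUpperSet (C : Set (Pd k))) :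
    2 ^ k * (∑ x, ind U x * ind B x * ind C x) ≤
      sStarD U B C + ∑ x, ∑ y, ind U x * ind B y * ind C y * (if TotDist x y = true then (1:ℤ) else 0) := by
  have hred := harrisReduced_eq_sum U B C
  -- the witness sum, chart by chart
  have hswap : (∑ u ∈ U, ∑ T : Finset (Fin k), (ind B (fromSet u T) - ind B u) * (ind C (fromSet u Tᶜ) - ind C u))
      = ∑ T : Finset (Fin k), ∑ u ∈ U, (ind B (fromSet u T) - ind B u) * (ind C (fromSet u Tᶜ) - ind C u) := Finset.sum_comm
  have hcompl : (∑ T : Finset (Fin k), ∑ u ∈ U, (ind B (fromSet u Tᶜ) - ind B u) * (ind C (fromSet u T) - ind C u))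
      = ∑ T : Finset (Fin k), ∑ u ∈ U, (ind B (fromSet u T) - ind B u) * (ind C (fromSet u Tᶜ) - ind C u) :=
    Fintype.sum_bijective _ compl_bijective _ _ fun T => by simp only [compl_compl]
  have hpair : 0 ≤ ∑ T : Finset (Fin k), ∑ u ∈ U, ((ind B (fromSet u T) - ind B u) * (ind C (fromSet u Tᶜ) - ind C u)
      + (ind B (fromSet u Tᶜ) - ind B u) * (ind C (fromSet u T) - ind C u)) :=
    Finset.sum_nonneg fun T _ => chartPair_sum_nonneg T hU htop hB hC
  have hsplit : (∑ T : Finset (Fin k), ∑ u ∈ U, ((ind B (fromSet u T) - ind B u) * (ind C (fromSet u Tᶜ) - ind C u)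
      + (ind B (fromSet u Tᶜ) - ind B u) * (ind C (fromSet u T) - ind C u)))
      = (∑ T : Finset (Fin k), ∑ u ∈ U, (ind B (fromSet u T) - ind B u) * (ind C (fromSet u Tᶜ) - ind C u))
        + ∑ T : Finset (Fin k), ∑ u ∈ U, (ind B (fromSet u Tᶜ) - ind B u) * (ind C (fromSet u T) - ind C u) := by
    rw [← Finset.sum_add_distrib]
    exact Finset.sum_congr rfl fun T _ => Finset.sum_add_distrib
  rw [hsplit, hcompl, ← hswap, ← hred] at hpair
  linarith

/-- **Every top-cube up-set is a GOOD SLOT**: `0 ≤ sStarD U B C` for all up-sets `B, C` (the Harris slack `H(U,B∩C)` is `≥ 0` by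
coefficientwise Harris, `tdPairs_le_card_inter`). [this work] -/
theorem sStarD_topCube_nonneg (U : Finset (Pd k)) (hU : IsUpperSet (U : Set (Pd k))) (htop : ∀ u ∈ U, ∀ a, u a ≠ 0)
    {B C : Finset (Pd k)} (hB : IsUpperSet (B : Set (Pd k))) (hC : IsUpperSet (C : Set (Pd k))) :
    0 ≤ sStarD U B C := by
  have h := sStarD_topCube_ge_harris U hU htop B C hB hC
  have hBC : ∀ y, ind B y * ind C y = ind (B ∩ C) y := fun y => (ind_inter_eq_mul B C y).symm
  have e1 : (∑ x, ind U x * ind B x * ind C x) = ((U ∩ (B ∩ C)).card : ℤ) := by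
    rw [← sum_ind_mul_ind_eq_card]
    exact Finset.sum_congr rfl fun x _ => by rw [mul_assoc, hBC]
  have e2 : (∑ x, ∑ y, ind U x * ind B y * ind C y * (if TotDist x y = true then (1:ℤ) else 0)) =
      ((((U ×ˢ (B ∩ C))).filter fun xy => TotDist xy.1 xy.2 = true).card : ℤ) := by
    rw [← sum_sum_ind_totDist_eq_card]
    exact Finset.sum_congr rfl fun x _ => Finset.sum_congr rfl fun y _ => by rw [mul_assoc (ind _ x), hBC]
  have hH := tdPairs_le_card_inter U (B ∩ C) hU (isUpperSet_inter_coe' hB hC)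
  rw [e1, e2] at h
  linarith

end Summit.CriticalPhenomena.PercolationContinuityZ3.Theorems.SahiGridPattern
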